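import Mathlib.MeasureTheory.Integral.IntervalIntegral.FundThmCalculus
import Mathlib.MeasureTheory.Measure.Haar.NormedSpace
import Mathlib.Analysis.SpecialFunctions.Pow.Integral
import Literature.Analysis.FluidPDE.NewtonKernel
import Literature.Analysis.FluidPDE.HarmonicProbe
import Literature.Analysis.FluidPDE.ClassicalSolutionCalculus
import HarnessLib

/-!
# The Newtonian potential on `ℝ³`: scaling, `∫ ΔΓ∞ = 1`, and the identity `ΔΓ₀ = δ₀ - λ`

Analysis/FluidPDE support file for the discharge of Tao's pressure-normalisation lemma
(`FluidPDE/NormalisedPressureProofs`, Tao 2011 Lemma 4.1 (i)); continues `NewtonKernel`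
(`Γ = Γ₀ + Γ∞`, `Γ₀ = θΓ` compactly supported, `Γ∞ = (1 - θ)Γ` smooth, `λ = ΔΓ∞` smooth with
compact support, `θ = radialCutoff r₀ r₁`), using the dilation/reflection calculus of
`HarmonicProbe`.

* Scaling (`newtonFar_scale`, `fderiv2_newtonFar_scale`, `newtonFarLaplacian_scale`): the kernels
  at cutoff radii `(c r₀, c r₁)` are `c⁻¹ Γ∞(c⁻¹ ·)`, `c⁻³ D²Γ∞(c⁻¹ ·)`, `c⁻³ λ(c⁻¹ ·)`.
* `integrable_newtonNear`: `Γ₀ ∈ L¹(ℝ³)` (`|Γ₀(z)| ≤ (4π|z|)⁻¹` near `0`).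
* `integral_newtonFarLaplacian`: **`∫ λ = 1`** — polar coordinates
  (`MeasureTheory.integral_fun_norm_addHaar`) and the fundamental theorem of calculus for the
  radial profile: `r² λ(r) = (2 r³ g'(r²))'` with `g` the profile of `Γ∞`, and
  `2r³ γ'(r²) = (4π)⁻¹` for the Newtonian profile `γ(σ) = -(4π)⁻¹σ^{-1/2}` (this is the flux
  `∫_{∂B_R} ∂Γ/∂ν = 1` of Gilbarg–Trudinger (2.17)/(2.18), computed without boundary integrals).
* `tendsto_integral_newtonFarLaplacian_smul`: the rescaled `λ`'s form an approximate identity.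
* `integral_newtonNear_mul_laplacian`: **`∫ Γ₀ Δφ = φ(0) - ∫ λ φ`** for `φ ∈ C²(ℝ³)` — the
  distributional identity `Δ(θΓ) = δ₀ - Δ((1-θ)Γ)`, i.e. Green's representation formula
  (Gilbarg–Trudinger (2.16)–(2.17)) localised by the cutoff; proved boundary-free via the
  regularisation `(1 - θ_δ)Γ₀ = Γ∞^{δ,2δ} - Γ∞^{r₀,r₁}` and `δ → 0`.
* `setIntegral_fderiv2_newtonFar_apply_self`: **`∫_{|z| ≤ r₁} D²Γ∞(z)(a,a) dz = |a|²/3`**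
  (isotropy of the second-moment tensor of a radial weight, `RadialCalculus`, and `∫ λ = 1`) —
  the trace term `δᵢⱼ/n` of Gilbarg–Trudinger Lemma 4.2 / (4.9).

## References

* D. Gilbarg, N. S. Trudinger, *Elliptic partial differential equations of second order*
  (Springer, 2001 reprint), (2.12)–(2.18), Lemma 4.2, (4.9)–(4.10).
* E. M. Stein, *Singular integrals and differentiability properties of functions* (1970),
  Ch. III §1.
* T. Tao, *Localisation and compactness properties of the Navier–Stokes global regularity
  problem*, Anal. PDE 6 (2013) = arXiv:1108.1165, §4, proof of Lemma 4.1.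
-/

noncomputable section

open MeasureTheory Set Filter Metric Topology InnerProductSpace Function Real
open scoped RealInnerProductSpace Laplacian ContDiff

namespace Literature.Analysis.FluidPDE

/-! (Dilation and reflection calculus for `fderiv`/`Δ`: see `FluidPDE/HarmonicProbe`.) -/

/-! ### Scaling of the kernels -/

section Newton

-- nested operator types `ℝ³ →L[ℝ] ℝ³ →L[ℝ] ℝ³ →L[ℝ] ℝ`
set_option maxSynthPendingDepth 3

/-- Local notation for physical space `ℝ³ = EuclideanSpace ℝ (Fin 3)`. -/
local notation "ℝ³" => EuclideanSpace ℝ (Fin 3)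

variable {r₀ r₁ : ℝ}

/-- **Scaling of `Γ∞`**: `Γ∞^{cr₀,cr₁}(z) = c⁻¹ Γ∞^{r₀,r₁}(c⁻¹z)`. [folklore] -/
theorem newtonFar_scale {c : ℝ} (hc : 0 < c) (r₀ r₁ : ℝ) (z : ℝ³) :
    newtonFar (c * r₀) (c * r₁) z = c⁻¹ * newtonFar r₀ r₁ (c⁻¹ • z) := by
  rw [newtonFar, newtonFar, radialCutoff_scale hc]
  have : newtonKernel z = c⁻¹ * newtonKernel (c⁻¹ • z) := by
    conv_lhs => rw [show z = c • (c⁻¹ • z) by rw [smul_smul, mul_inv_cancel₀ hc.ne', one_smul]]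
    exact newtonKernel_smul hc _
  rw [this]
  ring

/-- Scaling of `Γ∞`, function form: `Γ∞^{cr₀,cr₁} = c⁻¹ • Γ∞^{r₀,r₁}(c⁻¹ ·)`. [folklore] -/
theorem newtonFar_scale' {c : ℝ} (hc : 0 < c) (r₀ r₁ : ℝ) :
    newtonFar (c * r₀) (c * r₁) = fun z : ℝ³ => c⁻¹ • newtonFar r₀ r₁ (c⁻¹ • z) := by
  funext z
  rw [newtonFar_scale hc, smul_eq_mul]

/-- **Scaling of `Γ₀`**: `Γ₀^{cr₀,cr₁}(z) = c⁻¹ Γ₀^{r₀,r₁}(c⁻¹z)`. [folklore] -/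
theorem newtonNear_scale {c : ℝ} (hc : 0 < c) (r₀ r₁ : ℝ) (z : ℝ³) :
    newtonNear (c * r₀) (c * r₁) z = c⁻¹ * newtonNear r₀ r₁ (c⁻¹ • z) := by
  rw [newtonNear, newtonNear, radialCutoff_scale hc]
  have : newtonKernel z = c⁻¹ * newtonKernel (c⁻¹ • z) := by
    conv_lhs => rw [show z = c • (c⁻¹ • z) by rw [smul_smul, mul_inv_cancel₀ hc.ne', one_smul]]
    exact newtonKernel_smul hc _
  rw [this]
  ring

/-- **Scaling of `D²Γ∞`**: `D²Γ∞^{cr₀,cr₁}(z) = c⁻³ D²Γ∞^{r₀,r₁}(c⁻¹z)`. [folklore] -/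
theorem fderiv2_newtonFar_scale {c : ℝ} (hc : 0 < c) (r₀ r₁ : ℝ) (z : ℝ³) :
    fderiv ℝ (fderiv ℝ (newtonFar (c * r₀) (c * r₁))) z =
      c⁻¹ ^ 3 • fderiv ℝ (fderiv ℝ (newtonFar r₀ r₁)) (c⁻¹ • z) := by
  rw [newtonFar_scale' hc, fderiv2_const_smul_comp_smul _ _ (inv_ne_zero hc.ne')]
  simp only
  rw [show c⁻¹ * c⁻¹ ^ 2 = c⁻¹ ^ 3 by ring]

/-- **Scaling of `λ = ΔΓ∞`**: `λ^{cr₀,cr₁}(z) = c⁻³ λ^{r₀,r₁}(c⁻¹z)`. [folklore] -/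
theorem newtonFarLaplacian_scale {c : ℝ} (hc : 0 < c) (r₀ r₁ : ℝ) (z : ℝ³) :
    newtonFarLaplacian (c * r₀) (c * r₁) z = c⁻¹ ^ 3 * newtonFarLaplacian r₀ r₁ (c⁻¹ • z) := by
  rw [newtonFarLaplacian, newtonFarLaplacian, newtonFar_scale' hc,
    laplacian_const_smul_comp_smul _ _ (inv_ne_zero hc.ne'), smul_eq_mul]
  ring

/-- A uniform bound `‖D²Γ∞^{r₀,r₁}‖ ≤ M` rescales to `‖D²Γ∞^{cr₀,cr₁}‖ ≤ c⁻³ M`. [folklore] -/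
theorem norm_fderiv2_newtonFar_scale_le {c : ℝ} (hc : 0 < c) {M : ℝ}
    (hM : ∀ w, ‖fderiv ℝ (fderiv ℝ (newtonFar r₀ r₁)) w‖ ≤ M) (z : ℝ³) :
    ‖fderiv ℝ (fderiv ℝ (newtonFar (c * r₀) (c * r₁))) z‖ ≤ c⁻¹ ^ 3 * M := by
  rw [fderiv2_newtonFar_scale hc, norm_smul, norm_pow, norm_inv, Real.norm_eq_abs, abs_of_pos hc]
  exact mul_le_mul_of_nonneg_left (hM _) (by positivity)

/-- Substitution in integrals against the rescaled `λ`: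
`∫ λ^{cr₀,cr₁}(z) • φ(z) dz = ∫ λ^{r₀,r₁}(w) • φ(c w) dw`. [folklore] -/
theorem integral_newtonFarLaplacian_scale_smul {F : Type*} [NormedAddCommGroup F]
    [NormedSpace ℝ F] {c : ℝ} (hc : 0 < c) (r₀ r₁ : ℝ) (φ : ℝ³ → F) :
    ∫ z, newtonFarLaplacian (c * r₀) (c * r₁) z • φ z =
      ∫ w, newtonFarLaplacian r₀ r₁ w • φ (c • w) := by
  have h := Measure.integral_comp_inv_smul_of_nonneg volume
    (fun w : ℝ³ => newtonFarLaplacian r₀ r₁ w • φ (c • w)) hc.le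
  simp only [smul_smul, mul_inv_cancel₀ hc.ne', one_smul, finrank_euclideanSpace_fin] at h
  simp_rw [newtonFarLaplacian_scale hc, mul_smul, integral_smul, h, smul_smul]
  rw [show c⁻¹ ^ 3 * c ^ 3 = 1 by field_simp, one_smul]

/-- `∫ λ^{cr₀,cr₁} = ∫ λ^{r₀,r₁}`. [folklore] -/
theorem integral_newtonFarLaplacian_scale {c : ℝ} (hc : 0 < c) (r₀ r₁ : ℝ) :
    ∫ z, newtonFarLaplacian (c * r₀) (c * r₁) z = ∫ w, newtonFarLaplacian r₀ r₁ w := by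
  have := integral_newtonFarLaplacian_scale_smul hc r₀ r₁ (fun _ : ℝ³ => (1 : ℝ))
  simpa using this

/-- `∫ |λ^{cr₀,cr₁}| = ∫ |λ^{r₀,r₁}|`. [folklore] -/
theorem integral_abs_newtonFarLaplacian_scale {c : ℝ} (hc : 0 < c) (r₀ r₁ : ℝ) :
    ∫ z, |newtonFarLaplacian (c * r₀) (c * r₁) z| = ∫ w, |newtonFarLaplacian r₀ r₁ w| := by
  have h := Measure.integral_comp_inv_smul_of_nonneg volume
    (fun w : ℝ³ => |newtonFarLaplacian r₀ r₁ w|) hc.le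
  simp only [finrank_euclideanSpace_fin] at h
  simp_rw [newtonFarLaplacian_scale hc, abs_mul, integral_const_mul, h, abs_of_pos
    (by positivity : (0:ℝ) < c⁻¹ ^ 3), smul_eq_mul, ← mul_assoc]
  rw [show c⁻¹ ^ 3 * c ^ 3 = 1 by field_simp, one_mul]

/-- `∫ |Γ₀^{cr₀,cr₁}| = c² ∫ |Γ₀^{r₀,r₁}|`. [folklore] -/
theorem integral_abs_newtonNear_scale {c : ℝ} (hc : 0 < c) (r₀ r₁ : ℝ) :
    ∫ z, |newtonNear (c * r₀) (c * r₁) z| = c ^ 2 * ∫ w, |newtonNear r₀ r₁ w| := by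
  have h := Measure.integral_comp_inv_smul_of_nonneg volume
    (fun w : ℝ³ => |newtonNear r₀ r₁ w|) hc.le
  simp only [finrank_euclideanSpace_fin] at h
  simp_rw [newtonNear_scale hc, abs_mul, integral_const_mul, h, abs_of_pos (inv_pos.2 hc),
    smul_eq_mul, ← mul_assoc]
  rw [show c⁻¹ * c ^ 3 = c ^ 2 by field_simp]

/-! ### Measurability and integrability of `Γ₀` -/

/-- `Γ` is measurable. [folklore] -/
theorem measurable_newtonKernel : Measurable newtonKernel := by
  have : newtonKernel = fun z : ℝ³ => -(4 * π * ‖z‖)⁻¹ := funext newtonKernel_eq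
  rw [this]
  exact ((continuous_const.mul continuous_norm).measurable.inv).neg

/-- `Γ₀` is measurable. [folklore] -/
theorem measurable_newtonNear (r₀ r₁ : ℝ) : Measurable (newtonNear r₀ r₁) :=
  (radialCutoff_contDiff (E' := ℝ³) r₀ r₁ (n := 0)).continuous.measurable.mul
    measurable_newtonKernel

/-- **`Γ₀ ∈ L¹(ℝ³)`**: `|Γ₀(z)| ≤ (4π)⁻¹|z|⁻¹` with `1 < 3 = dim`, and compact support. [folklore] -/
theorem integrable_newtonNear (h₀ : 0 ≤ r₀) (h₁ : r₀ < r₁) : Integrable (newtonNear r₀ r₁) := by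
  have hsupp : support (newtonNear r₀ r₁) ⊆ ball (0 : ℝ³) (r₁ + 1) := fun z hz => by
    rw [mem_ball_zero_iff]
    by_contra h
    exact hz (newtonNear_eq_zero h₀ h₁ (by linarith [not_lt.1 h]))
  rw [← integrableOn_iff_integrable_of_support_subset hsupp]
  refine integrableOn_ball_of_norm_le_rpow (by rw [finrank_euclideanSpace_fin]; norm_num)
    (C := (4 * π)⁻¹) (α := 1) (by rw [finrank_euclideanSpace_fin]; norm_num)
    (Eventually.of_forall fun z => ?_) (measurable_newtonNear r₀ r₁).aestronglyMeasurable
  rw [Real.norm_eq_abs, Real.rpow_neg_one]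
  calc |newtonNear r₀ r₁ z| ≤ (4 * π * ‖z‖)⁻¹ := abs_newtonNear_le r₀ r₁ z
    _ = (4 * π)⁻¹ * ‖z‖⁻¹ := by rw [mul_inv]

/-! ### The radial profile of `Γ∞` -/

/-- The radial profile `g(σ) = (1 - Θ(σ)) γ(σ)` of `Γ∞` (`Γ∞(z) = g(|z|²)`); smooth on all of
`ℝ` (it vanishes for `σ < r₀²`). [folklore] -/
def newtonFarProfile (r₀ r₁ : ℝ) (σ : ℝ) : ℝ := (1 - cutoffProfile r₀ r₁ σ) * newtonProfile σ

/-- `Γ∞(z) = g(|z|²)` with `g` the far profile. [folklore] -/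
theorem newtonFar_eq_profile (r₀ r₁ : ℝ) (z : ℝ³) :
    newtonFar r₀ r₁ z = newtonFarProfile r₀ r₁ (‖z‖ ^ 2) := rfl

/-- `Γ∞ = g(|·|²)`, function form. [folklore] -/
theorem newtonFar_eq_profile' (r₀ r₁ : ℝ) :
    newtonFar r₀ r₁ = fun z : ℝ³ => newtonFarProfile r₀ r₁ (‖z‖ ^ 2) := rfl

/-- The profile vanishes for `σ < r₀²`. [folklore] -/
theorem newtonFarProfile_eventuallyEq_zero (h₀ : 0 ≤ r₀) (h₁ : r₀ < r₁) {σ : ℝ} (hσ : σ < r₀ ^ 2) :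
    newtonFarProfile r₀ r₁ =ᶠ[𝓝 σ] fun _ => 0 := by
  filter_upwards [isOpen_Iio.mem_nhds hσ] with τ hτ
  rw [newtonFarProfile, cutoffProfile_eq_one h₀ h₁ (le_of_lt hτ), sub_self, zero_mul]

/-- The profile agrees with the Newtonian profile `γ` for `σ > r₁²`. [folklore] -/
theorem newtonFarProfile_eventuallyEq_newtonProfile (h₀ : 0 ≤ r₀) (h₁ : r₀ < r₁) {σ : ℝ}
    (hσ : r₁ ^ 2 < σ) : newtonFarProfile r₀ r₁ =ᶠ[𝓝 σ] newtonProfile := by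
  filter_upwards [isOpen_Ioi.mem_nhds hσ] with τ hτ
  rw [newtonFarProfile, cutoffProfile_eq_zero h₀ h₁ (le_of_lt hτ), sub_zero, one_mul]

/-- **The profile of `Γ∞` is smooth on `ℝ`.** [folklore] -/
theorem contDiff_newtonFarProfile (h₀ : 0 < r₀) (h₁ : r₀ < r₁) {n : ℕ∞} :
    ContDiff ℝ n (newtonFarProfile r₀ r₁) := by
  refine contDiff_iff_contDiffAt.2 fun σ => ?_
  by_cases hσ : σ < r₀ ^ 2
  · exact (contDiffAt_const (c := (0 : ℝ))).congr_of_eventuallyEq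
      (newtonFarProfile_eventuallyEq_zero h₀.le h₁ hσ)
  · have hσ' : 0 < σ := (pow_pos h₀ 2).trans_le (not_lt.1 hσ)
    exact (contDiffAt_const.sub (cutoffProfile_contDiff r₀ r₁ (n := n)).contDiffAt).mul
      (contDiffAt_newtonProfile hσ')

/-- First derivative of the profile. [folklore] -/
def newtonFarProfile₁ (r₀ r₁ : ℝ) : ℝ → ℝ := deriv (newtonFarProfile r₀ r₁)

/-- Second derivative of the profile. [folklore] -/
def newtonFarProfile₂ (r₀ r₁ : ℝ) : ℝ → ℝ := deriv (newtonFarProfile₁ r₀ r₁)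

/-- `g` has derivative `g'` everywhere. [folklore] -/
theorem hasDerivAt_newtonFarProfile (h₀ : 0 < r₀) (h₁ : r₀ < r₁) (σ : ℝ) :
    HasDerivAt (newtonFarProfile r₀ r₁) (newtonFarProfile₁ r₀ r₁ σ) σ :=
  ((contDiff_newtonFarProfile h₀ h₁ (n := 1)).differentiable one_ne_zero σ).hasDerivAt

/-- `g'` is smooth. [folklore] -/
theorem contDiff_newtonFarProfile₁ (h₀ : 0 < r₀) (h₁ : r₀ < r₁) {n : ℕ∞} :
    ContDiff ℝ n (newtonFarProfile₁ r₀ r₁) := by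
  have h : ContDiff ℝ ((n : WithTop ℕ∞) + 1) (newtonFarProfile r₀ r₁) := by
    exact_mod_cast contDiff_newtonFarProfile h₀ h₁ (n := n + 1)
  rw [contDiff_succ_iff_deriv] at h
  exact h.2.2

/-- `g'` has derivative `g''` everywhere. [folklore] -/
theorem hasDerivAt_newtonFarProfile₁ (h₀ : 0 < r₀) (h₁ : r₀ < r₁) (σ : ℝ) :
    HasDerivAt (newtonFarProfile₁ r₀ r₁) (newtonFarProfile₂ r₀ r₁ σ) σ :=
  ((contDiff_newtonFarProfile₁ h₀ h₁ (n := 1)).differentiable one_ne_zero σ).hasDerivAt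

/-- `g'` is continuous. [folklore] -/
theorem continuous_newtonFarProfile₁ (h₀ : 0 < r₀) (h₁ : r₀ < r₁) :
    Continuous (newtonFarProfile₁ r₀ r₁) :=
  (contDiff_newtonFarProfile₁ h₀ h₁ (n := 0)).continuous

/-- `g''` is continuous. [folklore] -/
theorem continuous_newtonFarProfile₂ (h₀ : 0 < r₀) (h₁ : r₀ < r₁) :
    Continuous (newtonFarProfile₂ r₀ r₁) := by
  have h := contDiff_newtonFarProfile₁ h₀ h₁ (n := 1)
  rw [show ((1 : ℕ∞) : WithTop ℕ∞) = (0 : WithTop ℕ∞) + 1 by rfl, contDiff_succ_iff_deriv] at h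
  exact h.2.2.continuous

/-- `g' = 0` for `σ < r₀²`. [folklore] -/
theorem newtonFarProfile₁_eq_zero (h₀ : 0 < r₀) (h₁ : r₀ < r₁) {σ : ℝ} (hσ : σ < r₀ ^ 2) :
    newtonFarProfile₁ r₀ r₁ σ = 0 := by
  rw [newtonFarProfile₁, (newtonFarProfile_eventuallyEq_zero h₀.le h₁ hσ).deriv_eq, deriv_const]

/-- `g' = γ'` for `σ > r₁²`. [folklore] -/
theorem newtonFarProfile₁_eq_newtonProfile₁ (h₀ : 0 < r₀) (h₁ : r₀ < r₁) {σ : ℝ}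
    (hσ : r₁ ^ 2 < σ) : newtonFarProfile₁ r₀ r₁ σ = newtonProfile₁ σ := by
  have hσ' : 0 < σ := lt_trans (pow_pos (h₀.trans h₁) 2) hσ
  rw [newtonFarProfile₁, (newtonFarProfile_eventuallyEq_newtonProfile h₀.le h₁ hσ).deriv_eq,
    (hasDerivAt_newtonProfile hσ').deriv]

/-- **The Hessian of `Γ∞`** (everywhere, including the origin):
`D²Γ∞(z)(a, b) = 4 g''(|z|²) ⟨z,a⟩⟨z,b⟩ + 2 g'(|z|²) ⟨a,b⟩`. [folklore] -/
theorem fderiv2_newtonFar_apply (h₀ : 0 < r₀) (h₁ : r₀ < r₁) (z a b : ℝ³) :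
    fderiv ℝ (fderiv ℝ (newtonFar r₀ r₁)) z a b =
      4 * newtonFarProfile₂ r₀ r₁ (‖z‖ ^ 2) * ⟪z, b⟫ * ⟪z, a⟫ +
        2 * newtonFarProfile₁ r₀ r₁ (‖z‖ ^ 2) * ⟪b, a⟫ := by
  have hD : DifferentiableAt ℝ (fderiv ℝ (newtonFar r₀ r₁)) z := by
    rw [newtonFar_eq_profile']
    exact (hasFDerivAt_fderiv_comp_norm_sq (E := ℝ³) isOpen_univ
      (fun σ _ => hasDerivAt_newtonFarProfile h₀ h₁ σ) (mem_univ _)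
      (hasDerivAt_newtonFarProfile₁ h₀ h₁ _)).differentiableAt
  have h1 : fderiv ℝ (fderiv ℝ (newtonFar r₀ r₁)) z a b =
      fderiv ℝ (fun w => fderiv ℝ (newtonFar r₀ r₁) w b) z a := by
    rw [fderiv_clm_apply hD (differentiableAt_const b)]
    simp
  rw [h1, newtonFar_eq_profile', fderiv_fderiv_comp_norm_sq_apply (E := ℝ³) isOpen_univ
    (fun σ _ => hasDerivAt_newtonFarProfile h₀ h₁ σ) (mem_univ _)
    (hasDerivAt_newtonFarProfile₁ h₀ h₁ _) b a]

/-- **The Laplacian of `Γ∞`** (everywhere): `λ(z) = 4 g''(|z|²)|z|² + 6 g'(|z|²)`. [folklore] -/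
theorem newtonFarLaplacian_eq (h₀ : 0 < r₀) (h₁ : r₀ < r₁) (z : ℝ³) :
    newtonFarLaplacian r₀ r₁ z =
      4 * newtonFarProfile₂ r₀ r₁ (‖z‖ ^ 2) * ‖z‖ ^ 2 + 6 * newtonFarProfile₁ r₀ r₁ (‖z‖ ^ 2) := by
  rw [newtonFarLaplacian, newtonFar_eq_profile', laplacian_comp_norm_sq (E := ℝ³) isOpen_univ
    (fun σ _ => hasDerivAt_newtonFarProfile h₀ h₁ σ) (mem_univ _)
    (hasDerivAt_newtonFarProfile₁ h₀ h₁ _), finrank_euclideanSpace_fin]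
  push_cast
  ring

/-- The radial profile `Λ(r) = 4 g''(r²) r² + 6 g'(r²)` of `λ`, so that `λ(z) = Λ(|z|)`. [folklore] -/
def newtonFarLaplacianProfile (r₀ r₁ : ℝ) (r : ℝ) : ℝ :=
  4 * newtonFarProfile₂ r₀ r₁ (r ^ 2) * r ^ 2 + 6 * newtonFarProfile₁ r₀ r₁ (r ^ 2)

/-- `λ(z) = Λ(|z|)`. [folklore] -/
theorem newtonFarLaplacian_eq_profile (h₀ : 0 < r₀) (h₁ : r₀ < r₁) (z : ℝ³) :
    newtonFarLaplacian r₀ r₁ z = newtonFarLaplacianProfile r₀ r₁ ‖z‖ :=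
  newtonFarLaplacian_eq h₀ h₁ z

/-- `Λ` is continuous. [folklore] -/
theorem continuous_newtonFarLaplacianProfile (h₀ : 0 < r₀) (h₁ : r₀ < r₁) :
    Continuous (newtonFarLaplacianProfile r₀ r₁) := by
  unfold newtonFarLaplacianProfile
  exact ((continuous_const.mul ((continuous_newtonFarProfile₂ h₀ h₁).comp
    (continuous_pow 2))).mul (continuous_pow 2)).add
    (continuous_const.mul ((continuous_newtonFarProfile₁ h₀ h₁).comp (continuous_pow 2)))

/-- `Λ(r) = 0` for `r > r₁` (`λ` vanishes off the closed ball of radius `r₁`). [folklore] -/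
theorem newtonFarLaplacianProfile_eq_zero_of_gt (h₀ : 0 < r₀) (h₁ : r₀ < r₁) {r : ℝ}
    (hr : r₁ < r) : newtonFarLaplacianProfile r₀ r₁ r = 0 := by
  obtain ⟨e, he⟩ := exists_norm_eq ℝ³ zero_le_one
  have hr0 : 0 < r := lt_trans (h₀.trans h₁) hr
  have hn : ‖r • e‖ = r := by rw [norm_smul, he, mul_one, Real.norm_eq_abs, abs_of_pos hr0]
  rw [← hn, ← newtonFarLaplacian_eq_profile h₀ h₁,
    newtonFarLaplacian_eq_zero_of_gt h₀.le h₁ (by rwa [hn])]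

/-- `Λ(r) = 0` for `0 ≤ r < r₀` (`λ` vanishes on the open ball of radius `r₀`). [folklore] -/
theorem newtonFarLaplacianProfile_eq_zero_of_lt (h₀ : 0 < r₀) (h₁ : r₀ < r₁) {r : ℝ}
    (hr0 : 0 ≤ r) (hr : r < r₀) : newtonFarLaplacianProfile r₀ r₁ r = 0 := by
  obtain ⟨e, he⟩ := exists_norm_eq ℝ³ zero_le_one
  have hn : ‖r • e‖ = r := by rw [norm_smul, he, mul_one, Real.norm_eq_abs, abs_of_nonneg hr0]
  rw [← hn, ← newtonFarLaplacian_eq_profile h₀ h₁,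
    newtonFarLaplacian_eq_zero_of_lt h₀.le h₁ (by rwa [hn])]

/-- The radial primitive `F(r) = 2 r³ g'(r²)` with `F' = r² Λ`. [folklore] -/
theorem hasDerivAt_radialFlux (h₀ : 0 < r₀) (h₁ : r₀ < r₁) (r : ℝ) :
    HasDerivAt (fun r => 2 * r ^ 3 * newtonFarProfile₁ r₀ r₁ (r ^ 2))
      (r ^ 2 * newtonFarLaplacianProfile r₀ r₁ r) r := by
  have h1 : HasDerivAt (fun r : ℝ => r ^ 2) (2 * r) r := by
    simpa using hasDerivAt_pow 2 r
  have h2 : HasDerivAt (fun r : ℝ => newtonFarProfile₁ r₀ r₁ (r ^ 2))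
      (newtonFarProfile₂ r₀ r₁ (r ^ 2) * (2 * r)) r :=
    (hasDerivAt_newtonFarProfile₁ h₀ h₁ (r ^ 2)).comp r h1
  have h3 : HasDerivAt (fun r : ℝ => 2 * r ^ 3) (2 * (3 * r ^ 2)) r := by
    simpa using (hasDerivAt_pow 3 r).const_mul 2
  refine (h3.mul h2).congr_deriv ?_
  rw [newtonFarLaplacianProfile]
  ring

/-- The flux constant: `2 r³ γ'(r²) = (4π)⁻¹` beyond the cutoff. [folklore] -/
theorem radialFlux_eq_of_gt (h₀ : 0 < r₀) (h₁ : r₀ < r₁) {r : ℝ} (hr : r₁ < r) :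
    2 * r ^ 3 * newtonFarProfile₁ r₀ r₁ (r ^ 2) = (4 * π)⁻¹ := by
  have hr0 : 0 < r := lt_trans (h₀.trans h₁) hr
  have hσ : r₁ ^ 2 < r ^ 2 := by gcongr; linarith
  rw [newtonFarProfile₁_eq_newtonProfile₁ h₀ h₁ hσ, newtonProfile₁,
    ← Real.rpow_natCast r 2, ← Real.rpow_mul hr0.le]
  norm_num
  have hr3 : r ^ 3 ≠ 0 := by positivity
  field_simp
  ring

/-- **`∫_{ℝ³} λ = 1`** (`λ = Δ((1 - θ)Γ)`): the total flux of `∇Γ` through large spheres is `1`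
(Gilbarg–Trudinger (2.17)–(2.18)), here via polar coordinates and the fundamental theorem of
calculus applied to `r² Λ(r) = (2r³ g'(r²))'`. [cite: GilbargTrudinger2001, (2.17)] -/
theorem integral_newtonFarLaplacian (h₀ : 0 < r₀) (h₁ : r₀ < r₁) :
    ∫ z, newtonFarLaplacian r₀ r₁ z = 1 := by
  set Λ := newtonFarLaplacianProfile r₀ r₁ with hΛ
  have hΛc : Continuous Λ := continuous_newtonFarLaplacianProfile h₀ h₁
  -- polar coordinates
  have h1 : ∫ z, newtonFarLaplacian r₀ r₁ z = ∫ z : ℝ³, Λ ‖z‖ :=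
    integral_congr_ae (Eventually.of_forall fun z => newtonFarLaplacian_eq_profile h₀ h₁ z)
  rw [h1, integral_fun_norm_addHaar volume Λ]
  have h2 : (Module.finrank ℝ ℝ³ • (volume : Measure ℝ³).real (ball 0 1) : ℝ) = 4 * π := by
    rw [nsmul_eq_mul, ← unitSphereArea_eq, unitSphereArea_fin3]
  rw [← smul_assoc, h2, smul_eq_mul]
  -- the one-dimensional integral: `∫₀^∞ r² Λ(r) dr = (4π)⁻¹`
  set R := r₁ + 1 with hR
  set Fl : ℝ → ℝ := fun r => 2 * r ^ 3 * newtonFarProfile₁ r₀ r₁ (r ^ 2) with hFl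
  have hzero : ∀ r, r₁ < r → r ^ 2 * Λ r = 0 := fun r hr => by
    rw [hΛ, newtonFarLaplacianProfile_eq_zero_of_gt h₀ h₁ hr, mul_zero]
  have hIoc : IntegrableOn (fun r => r ^ 2 * Λ r) (Ioc 0 R) :=
    ((continuous_pow 2).mul hΛc).integrableOn_Icc.mono_set Ioc_subset_Icc_self
  have hIoi : IntegrableOn (fun r => r ^ 2 * Λ r) (Ioi R) := by
    refine (integrableOn_zero).congr_fun (fun r hr => ?_) measurableSet_Ioi
    exact (hzero r (by rw [mem_Ioi] at hr; linarith)).symm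
  have h3 : ∫ r in Ioi (0:ℝ), r ^ 2 * Λ r = ∫ r in Ioc (0:ℝ) R, r ^ 2 * Λ r := by
    rw [← Ioc_union_Ioi_eq_Ioi (by linarith : (0:ℝ) ≤ R),
      setIntegral_union (Set.Ioc_disjoint_Ioi le_rfl) measurableSet_Ioi hIoc hIoi]
    have : ∫ r in Ioi R, r ^ 2 * Λ r = 0 := by
      refine (setIntegral_congr_fun measurableSet_Ioi fun r hr => hzero r ?_).trans
        (integral_zero _ _)
      rw [mem_Ioi] at hr; linarith
    rw [this, add_zero]
  have h4 : ∫ r in Ioc (0:ℝ) R, r ^ 2 * Λ r = Fl R - Fl 0 := by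
    rw [← intervalIntegral.integral_of_le (by linarith : (0:ℝ) ≤ R)]
    exact intervalIntegral.integral_eq_sub_of_hasDerivAt
      (fun r _ => hasDerivAt_radialFlux h₀ h₁ r)
      (((continuous_pow 2).mul hΛc).intervalIntegrable _ _)
  have h5 : Fl R = (4 * π)⁻¹ := radialFlux_eq_of_gt h₀ h₁ (by linarith)
  have h6 : Fl 0 = 0 := by simp only [hFl]; ring
  have h8 : ∫ y in Ioi (0:ℝ), y ^ (Module.finrank ℝ ℝ³ - 1) • Λ y = (4 * π)⁻¹ := by
    simp_rw [finrank_euclideanSpace_fin, smul_eq_mul]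
    show ∫ y in Ioi (0:ℝ), y ^ 2 * Λ y = (4 * π)⁻¹
    rw [h3, h4, h5, h6, sub_zero]
  rw [h8, mul_inv_cancel₀ (by positivity)]

/-- `λ ∈ L¹`. [folklore] -/
theorem integrable_newtonFarLaplacian (h₀ : 0 < r₀) (h₁ : r₀ < r₁) :
    Integrable (newtonFarLaplacian r₀ r₁) :=
  (continuous_newtonFarLaplacian h₀ h₁).integrable_of_hasCompactSupport
    (hasCompactSupport_newtonFarLaplacian h₀.le h₁)

/-! ### The rescaled `λ`'s are an approximate identity -/

/-- **Approximate identity.** For continuous `φ`, `∫ λ^{c r₀, c r₁}(z) • φ(z) dz → φ(0)` as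
`c → 0⁺` (mass `∫ λ = 1`, support in `|z| ≤ c r₁`, `‖λ^{c·}‖₁` independent of `c`). [folklore] -/
theorem tendsto_integral_newtonFarLaplacian_smul {F : Type*} [NormedAddCommGroup F]
    [NormedSpace ℝ F] [CompleteSpace F] (h₀ : 0 < r₀) (h₁ : r₀ < r₁) {φ : ℝ³ → F}
    (hφ : Continuous φ) :
    Tendsto (fun c => ∫ z, newtonFarLaplacian (c * r₀) (c * r₁) z • φ z) (𝓝[>] 0)
      (𝓝 (φ 0)) := by
  set lam := newtonFarLaplacian r₀ r₁ with hlam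
  have hlamc : Continuous lam := continuous_newtonFarLaplacian h₀ h₁
  set I : ℝ → F := fun c => ∫ w, lam w • φ (c • w) with hI
  have hI0 : I 0 = φ 0 := by
    simp only [hI, zero_smul]
    rw [integral_smul_const, integral_newtonFarLaplacian h₀ h₁, one_smul]
  obtain ⟨M, hM⟩ : ∃ M, ∀ y ∈ closedBall (0 : ℝ³) r₁, ‖φ y‖ ≤ M :=
    (isCompact_closedBall 0 r₁).exists_bound_of_continuousOn hφ.continuousOn
  have hcont : ContinuousAt I 0 := by
    refine continuousAt_of_dominated (bound := fun w => ‖lam w‖ * M) ?_ ?_ ?_ ?_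
    · exact Eventually.of_forall fun c =>
        (by fun_prop : Continuous fun w : ℝ³ => lam w • φ (c • w)).aestronglyMeasurable
    · have hn : Icc (-1 : ℝ) 1 ∈ 𝓝 (0 : ℝ) := Icc_mem_nhds (by norm_num) (by norm_num)
      filter_upwards [hn] with c hc
      refine Eventually.of_forall fun w => ?_
      rw [norm_smul]
      by_cases hw : ‖w‖ ≤ r₁
      · refine mul_le_mul_of_nonneg_left (hM _ ?_) (norm_nonneg _)
        rw [mem_closedBall_zero_iff, norm_smul]
        calc ‖c‖ * ‖w‖ ≤ 1 * r₁ := by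
              refine mul_le_mul ?_ hw (norm_nonneg _) zero_le_one
              rw [Real.norm_eq_abs]
              exact abs_le.2 ⟨hc.1, hc.2⟩
          _ = r₁ := one_mul r₁
      · have : lam w = 0 := newtonFarLaplacian_eq_zero_of_gt h₀.le h₁ (not_le.1 hw)
        rw [this, norm_zero, zero_mul, zero_mul]
    · exact (integrable_newtonFarLaplacian h₀ h₁).norm.mul_const M
    · exact Eventually.of_forall fun w =>
        (continuous_const.smul (hφ.comp (continuous_id.smul continuous_const))).continuousAt
  have hT : Tendsto I (𝓝[>] 0) (𝓝 (φ 0)) := by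
    rw [← hI0]
    exact hcont.tendsto.mono_left nhdsWithin_le_nhds
  refine hT.congr' ?_
  filter_upwards [self_mem_nhdsWithin] with c hc
  exact (integral_newtonFarLaplacian_scale_smul hc r₀ r₁ φ).symm

/-! ### `ΔΓ₀ = δ₀ - λ`: the localised Green representation formula -/

/-- **The regularisation identity** `Γ∞^{δ,2δ} - Γ∞^{r₀,r₁} = (1 - θ_{δ,2δ}) Γ₀` for `2δ ≤ r₀`:
the regularised near kernel is an exact difference of two smooth far kernels. [folklore] -/
theorem newtonFar_sub_newtonFar {δ : ℝ} (hδ : 0 < δ) (hδr : δ * 2 ≤ r₀) (h₁ : r₀ < r₁)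
    (z : ℝ³) :
    newtonFar δ (δ * 2) z - newtonFar r₀ r₁ z =
      (1 - radialCutoff δ (δ * 2) z) * newtonNear r₀ r₁ z := by
  have hδ2 : δ < δ * 2 := by linarith
  have h₀ : 0 ≤ r₀ := by linarith
  rcases le_or_gt ‖z‖ r₀ with hz | hz
  · rw [newtonFar_eq_zero h₀ h₁ hz, newtonNear_eq_newtonKernel h₀ h₁ hz, sub_zero, newtonFar]
  · have hz' : δ * 2 ≤ ‖z‖ := by linarith
    rw [newtonFar_eq_newtonKernel hδ.le hδ2 hz', radialCutoff_eq_zero hδ.le hδ2 hz', sub_zero,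
      one_mul, newtonNear_eq_sub]

/-- Green's second identity for real functions, one of them compactly supported: the real-valued
reading of the tree's `Fluid.integral_inner_laplacian_comm` (`⟪x, y⟫_ℝ = y x`). [folklore] -/
theorem integral_mul_laplacian_comm {f g : ℝ³ → ℝ} (hf : ContDiff ℝ 2 f) (hg : ContDiff ℝ 2 g)
    (hc : HasCompactSupport g) : ∫ z, g z * (Δ f) z = ∫ z, (Δ g) z * f z := by
  have h := FluidPDE.integral_inner_laplacian_comm hf hg hc
  simpa only [RCLike.inner_apply, conj_trivial] using h

/-- **`∫ Γ₀ Δφ = φ(0) - ∫ λ φ` for `φ ∈ C²(ℝ³)`** (Gilbarg–Trudinger (2.16)–(2.17), Green's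
representation formula `φ(0) = ∫ Γ Δφ` for compactly supported `φ`, localised by the cutoff:
distributionally `Δ(θΓ) = δ₀ - Δ((1-θ)Γ)`). Boundary-free proof: for the smooth compactly
supported regularisation `K_δ = Γ∞^{δ,2δ} - Γ∞ = (1-θ_δ)Γ₀`, Green's second identity gives
`∫ K_δ Δφ = ∫ λ^{δ,2δ} φ - ∫ λ φ`; let `δ → 0⁺` (dominated convergence on the left, approximate
identity on the right). [cite: GilbargTrudinger2001, (2.17)] -/
theorem integral_newtonNear_mul_laplacian (h₀ : 0 < r₀) (h₁ : r₀ < r₁) {φ : ℝ³ → ℝ}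
    (hφ : ContDiff ℝ 2 φ) :
    ∫ z, newtonNear r₀ r₁ z * (Δ φ) z = φ 0 - ∫ z, newtonFarLaplacian r₀ r₁ z * φ z := by
  set Γ₀ := newtonNear r₀ r₁ with hΓ₀
  set lam := newtonFarLaplacian r₀ r₁ with hlam
  set K : ℝ → ℝ³ → ℝ := fun δ z => newtonFar δ (δ * 2) z - newtonFar r₀ r₁ z with hK
  have hΔφ : Continuous (Δ φ) := FluidPDE.continuous_laplacian hφ
  -- Step 1: Green's identity for the regularised kernel
  have step1 : ∀ δ, 0 < δ → δ * 2 ≤ r₀ → ∫ z, K δ z * (Δ φ) z =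
      (∫ z, newtonFarLaplacian δ (δ * 2) z * φ z) - ∫ z, lam z * φ z := by
    intro δ hδ hδr
    have hδ2 : δ < δ * 2 := by linarith
    have hKs : ContDiff ℝ 2 (K δ) := (contDiff_newtonFar hδ hδ2).sub (contDiff_newtonFar h₀ h₁)
    have hKc : HasCompactSupport (K δ) := by
      refine HasCompactSupport.intro (isCompact_closedBall (0 : ℝ³) r₁) fun z hz => ?_
      rw [mem_closedBall_zero_iff, not_le] at hz
      show newtonFar δ (δ * 2) z - newtonFar r₀ r₁ z = 0
      rw [newtonFar_sub_newtonFar hδ hδr h₁, newtonNear_eq_zero h₀.le h₁ hz.le, mul_zero]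
    have hΔK : ∀ z, (Δ (K δ)) z = newtonFarLaplacian δ (δ * 2) z - lam z := fun z => by
      have := ((contDiff_newtonFar hδ hδ2 (n := 2)).contDiffAt (x := z)).laplacian_sub
        ((contDiff_newtonFar h₀ h₁ (n := 2)).contDiffAt (x := z))
      exact this
    rw [integral_mul_laplacian_comm hφ hKs hKc]
    simp_rw [hΔK, sub_mul]
    refine integral_sub ?_ ?_
    · exact ((continuous_newtonFarLaplacian hδ hδ2).mul hφ.continuous).integrable_of_hasCompactSupport
        (hasCompactSupport_newtonFarLaplacian hδ.le hδ2).mul_right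
    · exact ((continuous_newtonFarLaplacian h₀ h₁).mul hφ.continuous).integrable_of_hasCompactSupport
        (hasCompactSupport_newtonFarLaplacian h₀.le h₁).mul_right
  -- Step 2: the left-hand side tends to `∫ Γ₀ Δφ`
  have hΓ₀i : Integrable Γ₀ := integrable_newtonNear h₀.le h₁
  obtain ⟨M, hM⟩ : ∃ M, ∀ y ∈ closedBall (0 : ℝ³) r₁, ‖(Δ φ) y‖ ≤ M :=
    (isCompact_closedBall 0 r₁).exists_bound_of_continuousOn hΔφ.continuousOn
  have hsmall : Ioc (0 : ℝ) (r₀ / 2) ∈ 𝓝[>] (0 : ℝ) := Ioc_mem_nhdsGT (by positivity)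
  have lim1 : Tendsto (fun δ => ∫ z, K δ z * (Δ φ) z) (𝓝[>] 0) (𝓝 (∫ z, Γ₀ z * (Δ φ) z)) := by
    refine tendsto_integral_filter_of_dominated_convergence (fun z => ‖Γ₀ z‖ * M) ?_ ?_ ?_ ?_
    · filter_upwards [self_mem_nhdsWithin] with δ hδ
      have hδ' : (0 : ℝ) < δ := hδ
      exact (((contDiff_newtonFar hδ' (by linarith) (n := 0)).continuous.sub
        (contDiff_newtonFar h₀ h₁ (n := 0)).continuous).mul hΔφ).aestronglyMeasurable
    · filter_upwards [hsmall] with δ hδ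
      refine Eventually.of_forall fun z => ?_
      show ‖(newtonFar δ (δ * 2) z - newtonFar r₀ r₁ z) * (Δ φ) z‖ ≤ ‖Γ₀ z‖ * M
      rw [newtonFar_sub_newtonFar hδ.1 (by linarith [hδ.2]) h₁, norm_mul, norm_mul]
      by_cases hz : ‖z‖ ≤ r₁
      · have hθ : ‖1 - radialCutoff δ (δ * 2) z‖ ≤ 1 := by
          rw [Real.norm_eq_abs, abs_le]
          constructor <;>
            linarith [radialCutoff_nonneg δ (δ * 2) z, radialCutoff_le_one δ (δ * 2) z]
        calc ‖1 - radialCutoff δ (δ * 2) z‖ * ‖Γ₀ z‖ * ‖(Δ φ) z‖ ≤ 1 * ‖Γ₀ z‖ * M := by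
              gcongr
              exact hM z (mem_closedBall_zero_iff.2 hz)
          _ = ‖Γ₀ z‖ * M := by ring
      · have hz0 : newtonNear r₀ r₁ z = 0 := newtonNear_eq_zero h₀.le h₁ (not_le.1 hz).le
        have hz0' : Γ₀ z = 0 := hz0
        rw [hz0, hz0', norm_zero, mul_zero, zero_mul, zero_mul]
    · exact hΓ₀i.norm.mul_const M
    · have hae : ∀ᵐ z ∂(volume : Measure ℝ³), z ≠ (0 : ℝ³) := by
        rw [ae_iff]
        simp
      filter_upwards [hae] with z hz
      have hzn : 0 < ‖z‖ := norm_pos_iff.2 hz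
      have hev : ∀ᶠ δ in 𝓝[>] (0 : ℝ), Γ₀ z * (Δ φ) z = K δ z * (Δ φ) z := by
        have hm : Ioo (0 : ℝ) (min (r₀ / 2) (‖z‖ / 2)) ∈ 𝓝[>] (0 : ℝ) :=
          Ioo_mem_nhdsGT (by positivity)
        filter_upwards [hm] with δ hδ
        have hδr : δ * 2 ≤ r₀ := by
          have := hδ.2; have := min_le_left (r₀ / 2) (‖z‖ / 2); linarith
        have hδz : δ * 2 ≤ ‖z‖ := by
          have := hδ.2; have := min_le_right (r₀ / 2) (‖z‖ / 2); linarith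
        show Γ₀ z * (Δ φ) z = (newtonFar δ (δ * 2) z - newtonFar r₀ r₁ z) * (Δ φ) z
        rw [newtonFar_sub_newtonFar hδ.1 hδr h₁,
          radialCutoff_eq_zero hδ.1.le (by linarith [hδ.1]) hδz, sub_zero, one_mul]
      exact tendsto_const_nhds.congr' hev
  -- Step 3: the right-hand side tends to `φ 0 - ∫ λ φ`
  have lim2 : Tendsto (fun δ => (∫ z, newtonFarLaplacian δ (δ * 2) z * φ z) - ∫ z, lam z * φ z)
      (𝓝[>] 0) (𝓝 (φ 0 - ∫ z, lam z * φ z)) := by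
    have h := tendsto_integral_newtonFarLaplacian_smul (r₀ := 1) (r₁ := 2) one_pos one_lt_two
      hφ.continuous
    simp only [mul_one, smul_eq_mul] at h
    exact h.sub_const _
  have lim1' : Tendsto (fun δ => ∫ z, K δ z * (Δ φ) z) (𝓝[>] 0)
      (𝓝 (φ 0 - ∫ z, lam z * φ z)) := by
    refine lim2.congr' ?_
    filter_upwards [hsmall] with δ hδ
    exact (step1 δ hδ.1 (by linarith [hδ.2])).symm
  exact tendsto_nhds_unique lim1 lim1'

/-! ### The trace term: `∫_{|z| ≤ r₁} D²Γ∞(z)(a,a) dz = |a|²/3` -/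

/-- **Isotropy of the regularised Hessian** (the `δᵢⱼ/n`-term of Gilbarg–Trudinger Lemma 4.2,
(4.9)): `∫_{|z| ≤ r₁} D²Γ∞^{r₀,r₁}(z)(a,a) dz = |a|²/3`. The Hessian of the radial `Γ∞` is
`4g''⟨z,a⟩⟨z,b⟩ + 2g'⟨a,b⟩`; the second-moment tensor of a radial weight is isotropic
(`integral_radial_mul_inner_mul_inner`), so the integral is `(|a|²/3) ∫_{|z|≤r₁} ΔΓ∞ = |a|²/3`.
[cite: GilbargTrudinger2001, Lemma 4.2] -/
theorem setIntegral_fderiv2_newtonFar_apply_self (h₀ : 0 < r₀) (h₁ : r₀ < r₁) (a : ℝ³) :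
    ∫ z in closedBall (0 : ℝ³) r₁, fderiv ℝ (fderiv ℝ (newtonFar r₀ r₁)) z a a = ‖a‖ ^ 2 / 3 := by
  set g₁ := newtonFarProfile₁ r₀ r₁ with hg₁
  set g₂ := newtonFarProfile₂ r₀ r₁ with hg₂
  have hg₁c : Continuous g₁ := continuous_newtonFarProfile₁ h₀ h₁
  have hg₂c : Continuous g₂ := continuous_newtonFarProfile₂ h₀ h₁
  set S := closedBall (0 : ℝ³) r₁ with hSdef
  have hS : MeasurableSet S := measurableSet_closedBall
  have hSc : IsCompact S := isCompact_closedBall _ _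
  have hint : ∀ z, fderiv ℝ (fderiv ℝ (newtonFar r₀ r₁)) z a a =
      4 * g₂ (‖z‖ ^ 2) * (⟪z, a⟫ * ⟪z, a⟫) + ‖a‖ ^ 2 * (2 * g₁ (‖z‖ ^ 2)) := fun z => by
    rw [fderiv2_newtonFar_apply h₀ h₁, real_inner_self_eq_norm_sq]
    ring
  simp_rw [hint]
  have hn2 : Continuous fun z : ℝ³ => ‖z‖ ^ 2 := continuous_norm.pow 2
  have hc1 : Continuous fun z : ℝ³ => 4 * g₂ (‖z‖ ^ 2) * (⟪z, a⟫ * ⟪z, a⟫) :=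
    (continuous_const.mul (hg₂c.comp hn2)).mul
      ((continuous_id.inner continuous_const).mul (continuous_id.inner continuous_const))
  have hc2 : Continuous fun z : ℝ³ => ‖a‖ ^ 2 * (2 * g₁ (‖z‖ ^ 2)) :=
    continuous_const.mul (continuous_const.mul (hg₁c.comp hn2))
  have hc3 : Continuous fun z : ℝ³ => 4 * g₂ (‖z‖ ^ 2) * ‖z‖ ^ 2 :=
    (continuous_const.mul (hg₂c.comp hn2)).mul hn2
  have hc4 : Continuous fun z : ℝ³ => 2 * g₁ (‖z‖ ^ 2) := continuous_const.mul (hg₁c.comp hn2)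
  have hi1 : IntegrableOn (fun z : ℝ³ => 4 * g₂ (‖z‖ ^ 2) * (⟪z, a⟫ * ⟪z, a⟫)) S :=
    hc1.continuousOn.integrableOn_compact hSc
  have hi2 : IntegrableOn (fun z : ℝ³ => ‖a‖ ^ 2 * (2 * g₁ (‖z‖ ^ 2))) S :=
    hc2.continuousOn.integrableOn_compact hSc
  have hi3 : IntegrableOn (fun z : ℝ³ => 4 * g₂ (‖z‖ ^ 2) * ‖z‖ ^ 2) S :=
    hc3.continuousOn.integrableOn_compact hSc
  have hi4 : IntegrableOn (fun z : ℝ³ => 2 * g₁ (‖z‖ ^ 2)) S :=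
    hc4.continuousOn.integrableOn_compact hSc
  rw [integral_add hi1 hi2]
  -- isotropy of the first term
  set ρ : ℝ³ → ℝ := S.indicator fun z => 4 * g₂ (‖z‖ ^ 2) with hρ
  have hρrad : ∀ x y : ℝ³, ‖x‖ = ‖y‖ → ρ x = ρ y := fun x y hxy => by
    simp only [hρ, indicator, hSdef, mem_closedBall_zero_iff, hxy]
  have hρm : AEStronglyMeasurable ρ volume :=
    (continuous_const.mul (hg₂c.comp hn2)).aestronglyMeasurable.indicator hS
  have hρi : Integrable (fun z => ρ z * ‖z‖ ^ 2) := by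
    have : (fun z => ρ z * ‖z‖ ^ 2) = S.indicator (fun z => 4 * g₂ (‖z‖ ^ 2) * ‖z‖ ^ 2) := by
      funext z
      simp only [hρ, indicator]
      split_ifs <;> simp
    rw [this, integrable_indicator_iff hS]
    exact hi3
  have iso := integral_radial_mul_inner_mul_inner hρrad hρm hρi a a
  rw [finrank_euclideanSpace_fin, real_inner_self_eq_norm_sq] at iso
  have e1 : ∫ z in S, 4 * g₂ (‖z‖ ^ 2) * (⟪z, a⟫ * ⟪z, a⟫) = ∫ z, ρ z * (⟪z, a⟫ * ⟪z, a⟫) := by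
    rw [← integral_indicator hS]
    refine integral_congr_ae (Eventually.of_forall fun z => ?_)
    simp only [hρ, indicator]
    split_ifs <;> simp
  have e2 : ∫ z, ρ z * ‖z‖ ^ 2 = ∫ z in S, 4 * g₂ (‖z‖ ^ 2) * ‖z‖ ^ 2 := by
    rw [← integral_indicator hS]
    refine integral_congr_ae (Eventually.of_forall fun z => ?_)
    simp only [hρ, indicator]
    split_ifs <;> simp
  have e3 : ∫ z in S, ‖a‖ ^ 2 * (2 * g₁ (‖z‖ ^ 2)) = ‖a‖ ^ 2 * ∫ z in S, 2 * g₁ (‖z‖ ^ 2) :=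
    integral_const_mul _ _
  -- `∫_S λ = 1`
  have e4 : ∫ z in S, (4 * g₂ (‖z‖ ^ 2) * ‖z‖ ^ 2 + 3 * (2 * g₁ (‖z‖ ^ 2))) = 1 := by
    have hS' : ∫ z in S, newtonFarLaplacian r₀ r₁ z = ∫ z, newtonFarLaplacian r₀ r₁ z :=
      setIntegral_eq_integral_of_forall_compl_eq_zero fun z hz =>
        newtonFarLaplacian_eq_zero_of_gt h₀.le h₁ (by
          simpa [hSdef, mem_closedBall_zero_iff] using hz)
    rw [← integral_newtonFarLaplacian h₀ h₁, ← hS']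
    refine setIntegral_congr_fun hS fun z _ => ?_
    rw [newtonFarLaplacian_eq h₀ h₁ z]
    ring
  have e5 : ∫ z in S, (4 * g₂ (‖z‖ ^ 2) * ‖z‖ ^ 2 + 3 * (2 * g₁ (‖z‖ ^ 2))) =
      (∫ z in S, 4 * g₂ (‖z‖ ^ 2) * ‖z‖ ^ 2) + 3 * ∫ z in S, 2 * g₁ (‖z‖ ^ 2) := by
    rw [← integral_const_mul, ← integral_add hi3 (hi4.const_mul 3)]
  rw [e1, iso, e2, e3]
  have e6 : ∫ z in S, 4 * g₂ (‖z‖ ^ 2) * ‖z‖ ^ 2 = 1 - 3 * ∫ z in S, 2 * g₁ (‖z‖ ^ 2) := by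
    linarith [e4, e5]
  rw [e6]
  push_cast
  ring

end Newton

end Literature.Analysis.FluidPDE

end
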